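import Mathlib.Algebra.Field.ZMod
import Literature.Combinatorics.Additive.RelativeSzemeredi
import Literature.Combinatorics.Additive.RelativeSzemerediCutNorm
import Literature.NumberTheory.Sieve.GreenTao2008
import HarnessLib

/-!
# Conlon–Fox–Zhao: proof of the relative Szemerédi theorem from its three inputs (§7)

Topic `Literature/Combinatorics/Additive`. Source: D. Conlon, J. Fox, Y. Zhao, *The Green–Tao
theorem: an exposition*, EMS Surv. Math. Sci. 1 (2014), 249–282 = arXiv:1403.2957 (held as
`paper:arxiv-1403.2957`; numbers are those of the arXiv version), §7 "Proof of the relative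
Szemerédi theorem". This is the PROOFS companion of `RelativeSzemeredi.lean` (the named fact
`Literature.Combinatorics.Additive.CFZ.RelativeSzemeredi`, Thm. 4.3) and `RelativeSzemerediCutNorm.lean` (cut norms, the
named facts `CFZ.DenseModel` = Thm. 5.1 and `CFZ.RelativeCounting` = Thm. 6.5). Everything here
is proved; the main result is the assembly

* `CFZ.relativeSzemeredi_of :
    GreenTao2008.SzemerediExpectation → CFZ.DenseModel → CFZ.RelativeCounting → CFZ.RelativeSzemeredi`,

i.e. §7 of the source: Theorem 4.3 from the weighted Szemerédi theorem (Thm. 4.1 = Green–Tao's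
Prop. 2.3, the tree's `Literature.NumberTheory.Sieve.GreenTao2008.SzemerediExpectation`), the dense model theorem and the
relative counting lemma. The steps, all proved:

* `CFZ.psi j` — the forms `ψ_j(x) = ∑_i (j - i) x_i` of §7, with `apForm j ω x = ψ_j(x^{(ω)})`
  (`CFZ.apForm_hat`) and the translation of the `ℤ_N`-linear forms condition
  (`CFZ.LinearFormsCondition`, Def. 4.2) into the hypergraph one for `ν_{-j} = ν ∘ ψ_j`
  (`CFZ.lfcWithin_of_linearFormsCondition`);
* `CFZ.abs_cutAverage_pow_le_boxPower` — Lemma 6.3 in `r` variables ("by a sequence of `k - 1`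
  applications of the Cauchy–Schwarz inequality"): the cut norm is dominated by the Gowers box
  norm, obtained from the tree's Gowers–Cauchy–Schwarz inequality `Literature.NumberTheory.Sieve.gowersCauchySchwarz`
  (Green–Tao 2010, Lemma B.2 / Cor. B.3); with the alternating expansion
  `CFZ.boxPower_sub_one_eq` this gives the first sentence of §7,
  `‖ν - 1‖_{□,k-1} = o(1)` (`CFZ.hasSmallCut_sub_one_of_lfcWithin`);
* the changes of variables (7.1)–(7.2) (`CFZ.hasSmallCut_psi_iff`, scaling by the units `j - i`
  of `ℤ_N`, `N` prime `≥ k`) and the relabelling invariance of `‖·‖_{□,k-1}`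
  (`CFZ.hasSmallCut_sum_erase_of_sum_erase`), both from `CFZ.hasSmallCut_map_iff`;
* the reparametrisation "`x = ψ_1(x_{-1})`, `d = x_1 + ⋯ + x_k`, so that `ψ_j(x_{-j}) = x + (j-1)d`"
  (`CFZ.expect_prod_psi_eq`, by two shears and a reflection of `ℤ_N^k`).

The constant produced is `c(k, δ/2)` of Thm. 4.1: the dense model `f̃` only has
`𝔼 f̃ ≥ δ - o(1)`, and the source's "at least `c(k,δ) - o_{k,δ}(1)` by Theorem 4.1" is applied at a
slightly smaller density; `CFZ.RelativeSzemeredi` asserts `∃ c > 0`, so nothing is lost.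

## References
* D. Conlon, J. Fox, Y. Zhao, *The Green–Tao theorem: an exposition*, EMS Surv. Math. Sci. 1
  (2014), 249–282, §7, Lemma 6.3, (7.1)–(7.4). [cite: ConlonFoxZhao2014]
* B. Green, T. Tao, *Linear equations in primes*, Ann. of Math. 171 (2010), App. B (the
  Gowers–Cauchy–Schwarz inequality used for Lemma 6.3).
-/

noncomputable section

open Filter Finset
open scoped BigOperators

namespace Literature.Combinatorics.Additive.CFZ

/-! ### The forms `ψ_j` and the translation of the linear forms condition -/

section psi

variable {k N : ℕ}

/-- The linear forms of §7: `ψ_j(x) = ∑_{i ∈ [k] ∖ {j}} (j - i) x_i` (the `i = j` term of the full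
sum vanishes; indices from `0`). [cite: ConlonFoxZhao2014, Section 7] -/
def psi (j : Fin k) (x : Fin k → ZMod N) : ZMod N :=
  ∑ i : Fin k, (((j : ℕ) : ZMod N) - ((i : ℕ) : ZMod N)) * x i

/-- `ψ_j` as a sum over `i ≠ j`. [cite: ConlonFoxZhao2014, Section 7] -/
theorem psi_eq_sum_erase (j : Fin k) (x : Fin k → ZMod N) :
    psi j x = ∑ i ∈ univ.erase j, (((j : ℕ) : ZMod N) - ((i : ℕ) : ZMod N)) * x i := by
  rw [psi, ← Finset.add_sum_erase _ _ (mem_univ j), sub_self, zero_mul, zero_add]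

/-- `ψ_j` does not depend on the coordinate `j` (it is a function on `X_{-j}`).
[cite: ConlonFoxZhao2014, Section 7] -/
theorem dependsOn_psi (j : Fin k) : DependsOn (psi (N := N) j) ({j}ᶜ : Set (Fin k)) := by
  intro x y hxy
  unfold psi
  refine Finset.sum_congr rfl fun i _ => ?_
  by_cases h : i = j
  · subst h; simp
  · rw [hxy i (by simpa using h)]

/-- `ψ_j(x) = ψ_0(x) + j · (x_1 + ⋯ + x_k)`: the `ψ_j` form a `k`-AP with common difference
`∑ x_i`. [cite: ConlonFoxZhao2014, Section 7] -/
theorem psi_eq_psi_zero_add (hk : 0 < k) (j : Fin k) (x : Fin k → ZMod N) :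
    psi j x = psi ⟨0, hk⟩ x + ((j : ℕ) : ZMod N) * ∑ i, x i := by
  simp only [psi, Finset.mul_sum, ← Finset.sum_add_distrib]
  refine Finset.sum_congr rfl fun i _ => ?_
  push_cast
  ring

/-- The vertex `ω ∈ {0,1}^{[k]}` attached to a finite set (`ω_i = 1 ↔ i ∈ ω`). [folklore] -/
def hat (ω : Finset (Fin k)) : Fin k → Fin 2 := fun i => if i ∈ ω then 1 else 0

/-- `hat` is injective. [folklore] -/
theorem hat_injective : Function.Injective (hat (k := k)) := by
  intro ω ω' h
  ext i
  have := congr_fun h i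
  by_cases h1 : i ∈ ω <;> by_cases h2 : i ∈ ω' <;> simp_all [hat]

/-- `x = (x_i^{(0)}, x_i^{(1)})_i ↦ (x⁽⁰⁾, x⁽¹⁾)`: the variables of Def. 4.2 as a pair of points.
[folklore] -/
def pairEquiv (k : ℕ) (Z : Type*) : (Fin k → Fin 2 → Z) ≃ (Fin k → Z) × (Fin k → Z) where
  toFun x := (fun i => x i 0, fun i => x i 1)
  invFun q := fun i c => if c = 0 then q.1 i else q.2 i
  left_inv x := by
    funext i c
    fin_cases c <;> simp
  right_inv q := by
    ext i <;> simp

/-- The forms of Def. 4.2 are the `ψ_j` at mixed points: `∑_i (j-i) x_i^{(ω_i)} = ψ_j(x^{(ω)})`.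
[cite: ConlonFoxZhao2014, Definition 4.2 and Section 7] -/
theorem apForm_hat (j : Fin k) (ω : Finset (Fin k)) (x : Fin k → Fin 2 → ZMod N) :
    apForm j (hat ω) x =
      psi j (Literature.NumberTheory.Sieve.mixPt (pairEquiv k (ZMod N) x).1 (pairEquiv k (ZMod N) x).2 ω) := by
  unfold apForm psi Literature.NumberTheory.Sieve.mixPt pairEquiv hat
  refine Finset.sum_congr rfl fun i _ => ?_
  by_cases h : i ∈ ω <;> simp [h]

/-- The embedding `(j, ω) ↦ (j, hat ω)` of hypergraph form labels into those of Def. 4.2.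
[folklore] -/
def hatEmb (k : ℕ) : Fin k × Finset (Fin k) ↪ Fin k × (Fin k → Fin 2) :=
  ⟨fun p => (p.1, hat p.2), fun p p' h => by
    simp only [Prod.mk.injEq] at h; exact Prod.ext h.1 (hat_injective h.2)⟩

/-- A hypergraph linear forms average for `ν_{-j} = ν ∘ ψ_j` is a linear forms average of
Def. 4.2. [cite: ConlonFoxZhao2014, Section 7] -/
theorem expect_prod_psi_mixPt_eq [NeZero N] (ν : ZMod N → ℝ)
    (E : Finset (Fin k × Finset (Fin k))) :
    (𝔼 q : (Fin k → ZMod N) × (Fin k → ZMod N), ∏ p ∈ E, ν (psi p.1 (Literature.NumberTheory.Sieve.mixPt q.1 q.2 p.2))) =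
      𝔼 x : Fin k → Fin 2 → ZMod N, ∏ p ∈ E.map (hatEmb k), ν (apForm p.1 p.2 x) := by
  rw [← Fintype.expect_equiv (pairEquiv k (ZMod N)).symm]
  intro q
  rw [Finset.prod_map]
  refine Finset.prod_congr rfl fun p _ => ?_
  simp only [hatEmb, Function.Embedding.coeFn_mk]
  rw [apForm_hat, Equiv.apply_symm_apply]

/-- **The `ℤ_N` linear forms condition gives the hypergraph one** ("the `k`-linear forms
condition for `ν : ℤ_N → [0,∞)` translates to the `k`-linear forms condition for the weighted
hypergraph `ν`", §7): if the family `ν` satisfies Def. 4.2 then, for every `η > 0` and all large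
primes `N`, the hypergraph `(ν_N ∘ ψ_j)_j` satisfies the linear forms condition within `η`.
[cite: ConlonFoxZhao2014, Section 7] -/
theorem lfcWithin_of_linearFormsCondition {ν : (N : ℕ) → ZMod N → ℝ}
    (hLFC : LinearFormsCondition k ν) {η : ℝ} (hη : 0 < η) :
    ∀ᶠ N : ℕ in atTop, ∀ [Fact N.Prime],
      LFCWithin (fun (j : Fin k) (x : Fin k → ZMod N) => ν N (psi j x)) η := by
  have : ∀ E : Finset (Fin k × Finset (Fin k)), ∀ᶠ N : ℕ in atTop, ∀ [Fact N.Prime],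
      (∀ p ∈ E, p.1 ∉ p.2) →
      |(𝔼 q : (Fin k → ZMod N) × (Fin k → ZMod N),
          ∏ p ∈ E, ν N (psi p.1 (Literature.NumberTheory.Sieve.mixPt q.1 q.2 p.2))) - 1| ≤ η := by
    intro E
    by_cases hE : ∀ p ∈ E, p.1 ∉ p.2
    · have h := hLFC (E.map (hatEmb k)) (by
          intro e he
          rw [Finset.mem_map] at he
          obtain ⟨p, hp, rfl⟩ := he
          simp only [hatEmb, Function.Embedding.coeFn_mk, hat, if_neg (hE p hp)]) η hη
      filter_upwards [h] with N hN
      intro _ _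
      haveI : NeZero N := ⟨(Fact.out : N.Prime).ne_zero⟩
      rw [expect_prod_psi_mixPt_eq]
      exact hN
    · exact Filter.Eventually.of_forall fun N _ h => absurd h hE
  rw [← Filter.eventually_all] at this
  filter_upwards [this] with N hN
  intro _ E hE
  exact hN E hE

end psi

/-! ### Lemma 6.3 in `r` variables: the cut norm is dominated by the Gowers box norm -/

section gcs

variable {ι : Type*} [DecidableEq ι] [Fintype ι] {X : Type*} [Fintype X]

/-- The family of functions on the faces of the cube `{0,1}^e` to which the
Gowers–Cauchy–Schwarz inequality is applied: `F` on the top face `e`, the decoration `1_{A_l}`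
on the face `e ∖ {l}`, and `1` elsewhere. [cite: ConlonFoxZhao2014, proof of Lemma 6.3] -/
def cutFam (e : Finset ι) (F : (ι → X) → ℝ) (a : ι → (ι → X) → ℝ) (B : Finset ι) (x : ι → X) :
    ℝ :=
  if B = e then F x else ∏ l ∈ e with e.erase l = B, a l x

omit [Fintype ι] [Fintype X] in
/-- The top face carries `F`. [folklore] -/
theorem cutFam_top (e : Finset ι) (F : (ι → X) → ℝ) (a : ι → (ι → X) → ℝ) :
    cutFam e F a e = F := by
  funext x; simp [cutFam]

omit [Fintype ι] [Fintype X] in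
/-- The product over all faces is the decorated integrand `F(x) ∏_l 1_{A_l}(x)`. [folklore] -/
theorem prod_cutFam (e : Finset ι) (F : (ι → X) → ℝ) (a : ι → (ι → X) → ℝ) (x : ι → X) :
    ∏ B ∈ e.powerset, cutFam e F a B x = F x * ∏ l ∈ e, a l x := by
  rw [← Finset.mul_prod_erase _ _ (Finset.mem_powerset_self e), cutFam_top]
  congr 1
  rw [← Finset.prod_fiberwise_of_maps_to (s := e) (t := e.powerset.erase e)
    (g := fun l => e.erase l) (fun l hl => Finset.mem_erase.mpr
      ⟨fun h => Finset.notMem_erase l e (by rw [h]; exact hl),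
        Finset.mem_powerset.mpr (Finset.erase_subset l e)⟩)]
  refine Finset.prod_congr rfl fun B hB => ?_
  rw [cutFam, if_neg (Finset.mem_erase.mp hB).1]

omit [Fintype ι] [Fintype X] in
/-- Each face function depends only on the coordinates of its face (and the undoubled ones).
[folklore] -/
theorem cutFam_dependsOn {e : Finset ι} (F : (ι → X) → ℝ) {a : ι → (ι → X) → ℝ}
    (ha : IsCutFamily e a) (B : Finset ι) (hB : B ⊆ e) :
    DependsOn (cutFam e F a B) ((↑B : Set ι) ∪ (↑e : Set ι)ᶜ) := by
  intro x y hxy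
  by_cases h : B = e
  · subst h
    simp only [cutFam, if_true]
    congr 1
    funext i
    exact hxy i (by rw [Set.mem_union, Set.mem_compl_iff]; exact em _)
  · simp only [cutFam, if_neg h]
    refine Finset.prod_congr rfl fun l hl => ?_
    rw [Finset.mem_filter] at hl
    refine ha.dependsOn l hl.1 fun i hi => hxy i (Or.inl ?_)
    rw [← hl.2]; exact hi

omit [Fintype ι] [Fintype X] in
/-- The lower faces carry `[0,1]`-valued functions. [folklore] -/
theorem cutFam_mem_Icc {e : Finset ι} (F : (ι → X) → ℝ) {a : ι → (ι → X) → ℝ}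
    (ha : IsCutFamily e a) {B : Finset ι} (hB : B ≠ e) (x : ι → X) :
    0 ≤ cutFam e F a B x ∧ cutFam e F a B x ≤ 1 := by
  simp only [cutFam, if_neg hB]
  exact ⟨Finset.prod_nonneg fun l _ => (ha.nonneg_le_one l x).1,
    Finset.prod_le_one (fun l _ => (ha.nonneg_le_one l x).1) fun l _ => (ha.nonneg_le_one l x).2⟩

variable [Nonempty X]

/-- The box power `‖g‖_{□^e}^{2^{|e|}}` of a `[0,1]`-valued function lies in `[0,1]`. [folklore] -/
theorem boxPower_mem_Icc (e : Finset ι) {g : (ι → X) → ℝ} (hg : ∀ x, 0 ≤ g x ∧ g x ≤ 1) :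
    0 ≤ Literature.NumberTheory.Sieve.boxPower e g ∧ Literature.NumberTheory.Sieve.boxPower e g ≤ 1 := by
  unfold Literature.NumberTheory.Sieve.boxPower Literature.NumberTheory.Sieve.boxProd
  constructor
  · exact Finset.expect_nonneg fun p _ => Finset.prod_nonneg fun ω _ => (hg _).1
  · refine (Finset.expect_le_expect fun p _ =>
      Finset.prod_le_one (fun ω _ => (hg _).1) fun ω _ => (hg _).2).trans ?_
    rw [Finset.expect_const Finset.univ_nonempty]

/-- **Cut norm versus Gowers box norm** (Lemma 6.3 of the source and its extension to `r`
coordinates used in §7, "by a sequence of `k - 1` applications of the Cauchy–Schwarz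
inequality"): for every cut family, `|𝔼 F ∏_l 1_{A_l}|^{2^{|e|}} ≤ ‖F‖_{□^e}^{2^{|e|}}`. Obtained
from the tree's Gowers–Cauchy–Schwarz inequality (`Literature.NumberTheory.Sieve.gowersCauchySchwarz`, Green–Tao 2010
Lemma B.2/Cor. B.3). [cite: ConlonFoxZhao2014, Lemma 6.3 and Section 7] -/
theorem abs_cutAverage_pow_le_boxPower {e : Finset ι} (he : e.Nonempty) (F : (ι → X) → ℝ)
    {a : ι → (ι → X) → ℝ} (ha : IsCutFamily e a) :
    |cutAverage e F a| ^ (2 ^ e.card) ≤ Literature.NumberTheory.Sieve.boxPower e F := by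
  have h1 : cutAverage e F a = 𝔼 y, Literature.NumberTheory.Sieve.boxProd e (cutFam e F a) y := by
    rw [← Literature.NumberTheory.Sieve.expect_prod_eq_expect_boxProd e (cutFam e F a)
      (fun B hB => cutFam_dependsOn F ha B hB)]
    simp only [prod_cutFam, cutAverage]
  rw [h1]
  refine (Literature.NumberTheory.Sieve.gowersCauchySchwarz he (cutFam e F a)).trans ?_
  rw [← Finset.mul_prod_erase _ _ (Finset.mem_powerset_self e), cutFam_top]
  refine mul_le_of_le_one_right (Literature.NumberTheory.Sieve.boxPower_nonneg he F) ?_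
  refine Finset.prod_le_one (fun B hB => ?_) fun B hB => ?_
  · exact (boxPower_mem_Icc e (cutFam_mem_Icc F ha (Finset.mem_erase.mp hB).1)).1
  · exact (boxPower_mem_Icc e (cutFam_mem_Icc F ha (Finset.mem_erase.mp hB).1)).2

omit [Nonempty X] in
/-- Expansion of `‖G - 1‖_{□^e}^{2^{|e|}}` as an alternating sum, over the sub-families `S` of the
vertices of the cube, of `𝔼 ∏_{ω ∈ S} G(x^{(ω)}) - 1` ("expand … into an alternating sum of linear
forms in `ν`, each being `1 + o(1)` …, so that the alternating sum cancels", Remark after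
Lemma 6.3). [cite: ConlonFoxZhao2014, Remark after Lemma 6.3] -/
theorem boxPower_sub_one_eq (e : Finset ι) (G : (ι → X) → ℝ) :
    Literature.NumberTheory.Sieve.boxPower e (fun x => G x - 1) =
      ∑ S ∈ e.powerset.powerset, (-1 : ℝ) ^ (e.powerset \ S).card *
        ((𝔼 p : (ι → X) × (ι → X), ∏ ω ∈ S, G (Literature.NumberTheory.Sieve.mixPt p.1 p.2 ω)) - 1) := by
  have hzero : ∑ S ∈ e.powerset.powerset, (-1 : ℝ) ^ (e.powerset \ S).card = 0 := by
    have h := Finset.prod_add (fun _ => (1 : ℝ)) (fun _ => (-1 : ℝ)) e.powerset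
    simp only [add_neg_cancel, Finset.prod_const_one, one_mul, Finset.prod_const] at h
    rw [← h]
    exact zero_pow (Finset.card_ne_zero.mpr ⟨∅, Finset.empty_mem_powerset e⟩)
  have hexp : Literature.NumberTheory.Sieve.boxPower e (fun x => G x - 1) =
      ∑ S ∈ e.powerset.powerset, (-1 : ℝ) ^ (e.powerset \ S).card *
        (𝔼 p : (ι → X) × (ι → X), ∏ ω ∈ S, G (Literature.NumberTheory.Sieve.mixPt p.1 p.2 ω)) := by
    unfold Literature.NumberTheory.Sieve.boxPower Literature.NumberTheory.Sieve.boxProd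
    simp_rw [sub_eq_add_neg, Finset.prod_add, Finset.prod_const, Finset.expect_sum_comm,
      Finset.mul_expect, mul_comm]
  rw [hexp]
  simp_rw [mul_sub, Finset.sum_sub_distrib, mul_one, hzero, sub_zero]

omit [Nonempty X] in
/-- **The linear forms condition controls `‖ν_{-j} - 1‖_{□}`**: if the weighted hypergraph `ν`
satisfies the `k`-linear forms condition within `η`, then
`|‖ν_{-j₀} - 1‖_{□^{[k]∖{j₀}}}^{2^{k-1}}| ≤ 2^{2^{k-1}} η` (each of the `2^{2^{k-1}}` averages in the
expansion is within `η` of `1`). [cite: ConlonFoxZhao2014, Remark after Lemma 6.3 and Section 7] -/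
theorem abs_boxPower_sub_one_le (νh : ι → (ι → X) → ℝ) (j₀ : ι) {η : ℝ} (hL : LFCWithin νh η) :
    |Literature.NumberTheory.Sieve.boxPower (univ.erase j₀) (fun x => νh j₀ x - 1)| ≤
      2 ^ (2 ^ (Fintype.card ι - 1)) * η := by
  rw [boxPower_sub_one_eq]
  refine (Finset.abs_sum_le_sum_abs _ _).trans ?_
  have hcard : ((univ.erase j₀).powerset.powerset).card = 2 ^ (2 ^ (Fintype.card ι - 1)) := by
    rw [Finset.card_powerset, Finset.card_powerset, Finset.card_erase_of_mem (mem_univ _),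
      Finset.card_univ]
  have : ∀ S ∈ (univ.erase j₀).powerset.powerset,
      |(-1 : ℝ) ^ ((univ.erase j₀).powerset \ S).card *
        ((𝔼 p : (ι → X) × (ι → X), ∏ ω ∈ S, νh j₀ (Literature.NumberTheory.Sieve.mixPt p.1 p.2 ω)) - 1)| ≤ η := by
    intro S hS
    rw [abs_mul, abs_pow, abs_neg, abs_one, one_pow, one_mul]
    let emb : Finset ι ↪ ι × Finset ι := ⟨fun ω => (j₀, ω), fun ω ω' h => by simpa using h⟩
    have hE := hL (S.map emb) (by
      intro p hp
      rw [Finset.mem_map] at hp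
      obtain ⟨ω, hω, rfl⟩ := hp
      have hω' : ω ⊆ univ.erase j₀ := Finset.mem_powerset.mp (Finset.mem_powerset.mp hS hω)
      exact fun h => (Finset.notMem_erase j₀ univ) (hω' h))
    simpa [Finset.prod_map, emb] using hE
  refine (Finset.sum_le_sum this).trans ?_
  rw [Finset.sum_const, hcard, nsmul_eq_mul]
  push_cast
  rfl

/-- **`‖ν_{-j₀} - 1‖_□` is small under the linear forms condition** (the first sentence of the
proof of Thm. 4.3 in §7: "The `k`-linear forms condition implies that
`‖ν - 1‖_{□,k-1} = o(1)`", via Lemma 6.3). Quantitatively: linear forms within `η` and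
`2^{2^{k-1}} η ≤ ε'^{2^{k-1}}` give `‖ν_{-j₀} - 1‖_□ ≤ ε'`.
[cite: ConlonFoxZhao2014, Section 7 and Lemma 6.3] -/
theorem hasSmallCut_sub_one_of_lfcWithin (νh : ι → (ι → X) → ℝ) (j₀ : ι) {η ε' : ℝ}
    (hL : LFCWithin νh η) (hε' : 0 ≤ ε') (hι : 2 ≤ Fintype.card ι)
    (hη : 2 ^ (2 ^ (Fintype.card ι - 1)) * η ≤ ε' ^ (2 ^ (Fintype.card ι - 1))) :
    HasSmallCut (univ.erase j₀) (fun x => νh j₀ x - 1) ε' := by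
  intro a ha
  have hcard : (univ.erase j₀).card = Fintype.card ι - 1 := by
    rw [Finset.card_erase_of_mem (mem_univ _), Finset.card_univ]
  have he : (univ.erase j₀).Nonempty := by
    rw [← Finset.card_pos, hcard]; omega
  have h1 := abs_cutAverage_pow_le_boxPower he (fun x => νh j₀ x - 1) ha
  rw [hcard] at h1
  have h2 := (le_abs_self _).trans (abs_boxPower_sub_one_le νh j₀ hL)
  exact le_of_pow_le_pow_left₀ (pow_ne_zero _ two_ne_zero) hε' ((h1.trans h2).trans hη)

end gcs

/-! ### The reparametrisation of §7 -/


section reparam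

variable {k N : ℕ} [NeZero N]

/-- **The reparametrisation of §7**: "setting `x = ψ_1(x_{-1})` and `d = x_1 + ⋯ + x_k` so that
`ψ_j(x_{-j}) = x + (j-1)d`" — the pair `(ψ_0(x), ∑_i x_i)` is equidistributed on `ℤ_N^2` as `x`
ranges over `ℤ_N^k`, `k ≥ 2` (two shears and a reflection). [cite: ConlonFoxZhao2014, Section 7] -/
theorem expect_psi_zero_sum_eq (hk : 2 ≤ k) (H : ZMod N → ZMod N → ℝ) :
    (𝔼 x : Fin k → ZMod N, H (psi ⟨0, by omega⟩ x) (∑ i, x i)) =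
      𝔼 a : ZMod N, 𝔼 d : ZMod N, H a d := by
  set i₀ : Fin k := ⟨0, by omega⟩ with hi₀
  set i₁ : Fin k := ⟨1, by omega⟩ with hi₁
  have h01 : i₁ ≠ i₀ := by simp [hi₀, hi₁, Fin.ext_iff]
  have hpsi0 : ∀ x u, psi i₀ (Function.update x i₀ u) = psi (N := N) i₀ x := fun x u =>
    dependsOn_psi i₀ fun i hi => Function.update_of_ne (by simpa using hi) _ _
  -- first shear: `x_{i₀} ↦ x_{i₀} - ∑_{i ≠ i₀} x_i`, after which `∑ x = x_{i₀}`
  let S₁ : (Fin k → ZMod N) → ZMod N := fun x => ∑ i ∈ univ.erase i₀, x i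
  have hS₁ : ∀ x u, S₁ (Function.update x i₀ u) = S₁ x := fun x u =>
    Finset.sum_congr rfl fun i hi => Function.update_of_ne (Finset.ne_of_mem_erase hi) _ _
  have step1 : (𝔼 x : Fin k → ZMod N, H (psi i₀ x) (∑ i, x i)) =
      𝔼 x : Fin k → ZMod N, H (psi i₀ x) (x i₀) := by
    rw [← Literature.NumberTheory.Sieve.expect_comp_equiv (shear i₀ S₁ hS₁) (fun x => H (psi i₀ x) (∑ i, x i))]
    refine Finset.expect_congr rfl fun x _ => ?_
    rw [shear_apply, hpsi0]
    congr 1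
    rw [← Finset.add_sum_erase _ _ (mem_univ i₀), Function.update_self]
    have : ∑ i ∈ univ.erase i₀, Function.update x i₀ (x i₀ - S₁ x) i = S₁ x :=
      Finset.sum_congr rfl fun i hi => Function.update_of_ne (Finset.ne_of_mem_erase hi) _ _
    rw [this, sub_add_cancel]
  -- second shear at `i₁`: `ψ_0(x) = -x_{i₁} + R(x)` with `R` independent of `x_{i₁}`
  let R : (Fin k → ZMod N) → ZMod N :=
    fun x => ∑ i ∈ univ.erase i₁, (((i₀ : ℕ) : ZMod N) - ((i : ℕ) : ZMod N)) * x i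
  have hR : ∀ x u, R (Function.update x i₁ u) = R x := fun x u =>
    Finset.sum_congr rfl fun i hi => by rw [Function.update_of_ne (Finset.ne_of_mem_erase hi)]
  have hpsiR : ∀ x : Fin k → ZMod N, psi i₀ x = -x i₁ + R x := by
    intro x
    rw [psi, ← Finset.add_sum_erase _ _ (mem_univ i₁)]
    simp [hi₀, hi₁, R]
  let S₂ : (Fin k → ZMod N) → ZMod N := fun x => -R x
  have hS₂ : ∀ x u, S₂ (Function.update x i₁ u) = S₂ x := fun x u => by
    simp only [S₂, hR]
  have step2 : (𝔼 x : Fin k → ZMod N, H (psi i₀ x) (x i₀)) =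
      𝔼 x : Fin k → ZMod N, H (-x i₁) (x i₀) := by
    rw [← Literature.NumberTheory.Sieve.expect_comp_equiv (shear i₁ S₂ hS₂) (fun x => H (psi i₀ x) (x i₀))]
    refine Finset.expect_congr rfl fun x _ => ?_
    rw [shear_apply, hpsiR, hR, Function.update_self, Function.update_of_ne h01.symm]
    congr 1
    simp only [S₂]; ring
  -- reflection `x_{i₁} ↦ -x_{i₁}`
  have step3 : (𝔼 x : Fin k → ZMod N, H (-x i₁) (x i₀)) =
      𝔼 x : Fin k → ZMod N, H (x i₁) (x i₀) := by
    let ρ : (Fin k → ZMod N) ≃ (Fin k → ZMod N) := Function.Involutive.toPerm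
      (fun x => Function.update x i₁ (-x i₁)) fun x => by simp
    rw [← Literature.NumberTheory.Sieve.expect_comp_equiv ρ (fun x => H (-x i₁) (x i₀))]
    refine Finset.expect_congr rfl fun x _ => ?_
    simp [ρ, Function.update_of_ne h01.symm]
  -- marginalisation
  have step4 : (𝔼 x : Fin k → ZMod N, H (x i₁) (x i₀)) =
      𝔼 a : ZMod N, 𝔼 d : ZMod N, H a d := by
    rw [← Literature.NumberTheory.Sieve.expect_expect_update i₀ (fun x : Fin k → ZMod N => H (x i₁) (x i₀))]
    simp only [Function.update_self, Function.update_of_ne h01]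
    rw [← Literature.NumberTheory.Sieve.expect_expect_update i₁ (fun x : Fin k → ZMod N => 𝔼 u : ZMod N, H (x i₁) u)]
    simp only [Function.update_self]
    exact Finset.expect_const Finset.univ_nonempty _
  rw [step1, step2, step3, step4]

/-- The `k`-AP count as a simplex count: `𝔼_{x ∈ ℤ_N^k} ∏_j F(ψ_j(x)) = 𝔼_{a,d} ∏_j F(a + j d)`
((7.3) ⟺ (7.4) of the source). [cite: ConlonFoxZhao2014, Section 7] -/
theorem expect_prod_psi_eq (hk : 2 ≤ k) (F : ZMod N → ℝ) :
    (𝔼 x : Fin k → ZMod N, ∏ j : Fin k, F (psi j x)) =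
      𝔼 a : ZMod N, 𝔼 d : ZMod N, ∏ j : Fin k, F (a + ((j : ℕ) : ZMod N) * d) := by
  rw [← expect_psi_zero_sum_eq hk (fun a d => ∏ j : Fin k, F (a + ((j : ℕ) : ZMod N) * d))]
  refine Finset.expect_congr rfl fun x _ => Finset.prod_congr rfl fun j _ => ?_
  rw [psi_eq_psi_zero_add (by omega) j x]

end reparam

/-! ### The two changes of variables of §7: relabelling and the scaling (7.1)–(7.2) -/

section transportZ

variable {k N : ℕ} [NeZero N]

/-- Relabelling: `‖F(∑_{i ≠ j₀} x_i)‖_□ ≤ ε → ‖F(∑_{i ≠ j} x_i)‖_□ ≤ ε` (the cut norm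
`‖F‖_{□,k-1}` does not depend on which `k - 1` of the `k` coordinates carry it). [folklore] -/
theorem hasSmallCut_sum_erase_of_sum_erase (j₀ j : Fin k) (F : ZMod N → ℝ) {ε : ℝ}
    (h : HasSmallCut (univ.erase j₀)
      (fun x : Fin k → ZMod N => F (∑ i ∈ univ.erase j₀, x i)) ε) :
    HasSmallCut (univ.erase j) (fun x : Fin k → ZMod N => F (∑ i ∈ univ.erase j, x i)) ε := by
  let τ : Fin k ≃ Fin k := Equiv.swap j₀ j
  have he : (univ.erase j₀).map τ.toEmbedding = univ.erase j := by
    rw [Finset.map_erase, Finset.map_univ_equiv]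
    simp [τ]
  rw [← he, hasSmallCut_map_iff τ (fun _ => Equiv.refl (ZMod N))]
  convert h using 2 with x
  congr 1
  rw [Finset.sum_map]
  exact Finset.sum_congr rfl fun i _ => pointMap_apply τ _ x i

/-- **Scaling, (7.1)–(7.2).** For `N` prime and `k ≤ N` the coefficients `j - i`, `i ≠ j`, are
units of `ℤ_N` ("here we use the assumption … that `N` is coprime to `(k-1)!`"), so
`‖F(ψ_j(x))‖_□ ≤ ε ↔ ‖F(∑_{i ≠ j} x_i)‖_□ ≤ ε` — the hypergraph cut norm of `F ∘ ψ_j` is the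
cut norm `‖F‖_{□,k-1}`. [cite: ConlonFoxZhao2014, Section 7, (7.1)–(7.2)] -/
theorem hasSmallCut_psi_iff [Fact N.Prime] (hkN : k ≤ N) (j : Fin k) (F : ZMod N → ℝ)
    (ε : ℝ) :
    HasSmallCut (univ.erase j) (fun x : Fin k → ZMod N => F (psi j x)) ε ↔
      HasSmallCut (univ.erase j) (fun x : Fin k → ZMod N => F (∑ i ∈ univ.erase j, x i)) ε := by
  -- the units `j - i`
  have hunit : ∀ i : Fin k, i ≠ j → (((j : ℕ) : ZMod N) - ((i : ℕ) : ZMod N)) ≠ 0 := by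
    intro i hij h
    rw [sub_eq_zero, ZMod.natCast_eq_natCast_iff', Nat.mod_eq_of_lt (by omega),
      Nat.mod_eq_of_lt (by omega)] at h
    exact hij (Fin.ext h.symm)
  let c : Fin k → ZMod N :=
    fun i => if h : i = j then 1 else ((j : ℕ) : ZMod N) - ((i : ℕ) : ZMod N)
  have hc : ∀ i, c i ≠ 0 := fun i => by
    by_cases h : i = j
    · simp [c, h]
    · simp only [c, dif_neg h]; exact hunit i h
  let φ : Fin k → ZMod N ≃ ZMod N := fun i => Equiv.mulLeft₀ (c i) (hc i)
  have key := hasSmallCut_map_iff (Equiv.refl (Fin k)) φ (univ.erase j)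
    (fun x : Fin k → ZMod N => F (∑ i ∈ univ.erase j, x i)) ε
  rw [Equiv.refl_toEmbedding, Finset.map_refl] at key
  rw [key]
  refine iff_of_eq (congrArg (fun G => HasSmallCut (univ.erase j) G ε) (funext fun x => ?_))
  rw [psi_eq_sum_erase]
  congr 1
  refine Finset.sum_congr rfl fun i hi => ?_
  have hij : i ≠ j := Finset.ne_of_mem_erase hi
  have := pointMap_apply (Equiv.refl (Fin k)) φ x i
  simp only [Equiv.refl_apply] at this
  rw [this]
  simp [φ, c, hij]

end transportZ

/-! ### §7: the relative Szemerédi theorem from Theorems 4.1, 5.1 and 6.5 -/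

/-- **Conlon–Fox–Zhao, proof of Theorem 4.3 (§7).** The relative Szemerédi theorem
`CFZ.RelativeSzemeredi` follows from the weighted Szemerédi theorem (Thm. 4.1 = Green–Tao's
Prop. 2.3, the tree's `Literature.NumberTheory.Sieve.GreenTao2008.SzemerediExpectation`), the dense model theorem
(Thm. 5.1, `CFZ.DenseModel`) and the relative simplex counting lemma (Thm. 6.5,
`CFZ.RelativeCounting`): the linear forms condition gives `‖ν - 1‖_{□,k-1} = o(1)`; the dense
model theorem gives `f̃ : ℤ_N → [0,1]` with `‖f - f̃‖_{□,k-1} = o(1)` (whence `𝔼 f̃ ≥ δ - o(1)`);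
with `ν_{-j} = ν ∘ ψ_j`, `g_{-j} = f ∘ ψ_j`, `g̃_{-j} = f̃ ∘ ψ_j` the counting lemma applies after
the changes of variables (7.1)–(7.2), and `𝔼_{x ∈ ℤ_N^k} ∏_j F(ψ_j(x)) = 𝔼_{x,d} ∏_j F(x + jd)`.
The constant obtained is `c(k, δ/2)` of Thm. 4.1 (the source applies Thm. 4.1 at density
`δ - o(1)`). [cite: ConlonFoxZhao2014, Section 7 (proof of Theorem 4.3)] -/
theorem relativeSzemeredi_of (hSz : Literature.NumberTheory.Sieve.GreenTao2008.SzemerediExpectation) (hDM : DenseModel)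
    (hCL : RelativeCounting) : RelativeSzemeredi := by
  intro k hk δ hδ hδ1
  obtain ⟨c, hc, hSz'⟩ := hSz k (by omega) (δ / 2) (by positivity) (by linarith)
  refine ⟨c, hc, fun ν hν hLFC η hη => ?_⟩
  -- tolerances: counting lemma, dense model, linear forms
  obtain ⟨δ₁, hδ₁, hCL'⟩ := hCL k (η / 2) (by positivity)
  set j₀ : Fin k := ⟨0, by omega⟩ with hj₀
  obtain ⟨ε', hε', hDM'⟩ :=
    hDM (Fin k) (univ.erase j₀) (min δ₁ (δ / 2)) (lt_min hδ₁ (by positivity))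
  set η₁ : ℝ := ε' ^ (2 ^ (k - 1)) / 2 ^ (2 ^ (k - 1)) with hη₁
  have hη₁pos : 0 < η₁ := by positivity
  have hη₀pos : 0 < min δ₁ η₁ := lt_min hδ₁ hη₁pos
  -- the three eventualities in `N`
  filter_upwards [eventually_ge_atTop k, lfcWithin_of_linearFormsCondition hLFC hη₀pos,
    hSz' (η / 2) (by positivity)] with N hNk hL hS
  intro hprime f hf0 hfν hfδ
  haveI : NeZero N := ⟨hprime.out.ne_zero⟩
  have hL' : LFCWithin (fun (j : Fin k) (x : Fin k → ZMod N) => ν N (psi j x)) (min δ₁ η₁) := hL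
  have hcard : Fintype.card (Fin k) = k := Fintype.card_fin k
  -- Step 1: `‖ν - 1‖_{□,k-1} ≤ ε'` (Lemma 6.3 / Gowers–Cauchy–Schwarz, then the scaling (7.1))
  have hν1 : HasSmallCut (univ.erase j₀) (fun x : Fin k → ZMod N => ν N (psi j₀ x) - 1) ε' := by
    refine hasSmallCut_sub_one_of_lfcWithin (fun j x => ν N (psi j x)) j₀
      (hL'.mono (min_le_right _ _)) hε'.le ?_ ?_
    · rw [hcard]; omega
    · rw [hcard, hη₁, mul_div_cancel₀ _ (by positivity)]
  have hν1' : HasSmallCut (univ.erase j₀)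
      (fun x : Fin k → ZMod N => ν N (∑ i ∈ univ.erase j₀, x i) - 1) ε' :=
    (hasSmallCut_psi_iff hNk j₀ (fun z => ν N z - 1) ε').mp hν1
  -- Step 2: the dense model `g = f̃`
  obtain ⟨g, hg0, hg1, hcut⟩ := hDM' N (ν N) (hν N) hν1' f hf0 hfν
  -- Step 3: `𝔼 g ≥ δ/2`, and Szemerédi's theorem for `g`
  have hEg : δ / 2 ≤ 𝔼 x, g x := by
    have h1 := hcut.abs_expect_le
    have he : (univ.erase j₀ : Finset (Fin k)).Nonempty := by
      rw [← Finset.card_pos, Finset.card_erase_of_mem (mem_univ _), Finset.card_univ, hcard]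
      omega
    rw [expect_comp_sum_eq he (fun z => f z - g z), Finset.expect_sub_distrib] at h1
    have h2 := (abs_le.mp (h1.trans (min_le_right _ _))).2
    linarith
  have hSg := hS g hg0 hg1 hEg
  -- Step 4: cut norms of `g_{-j} - g̃_{-j}` (relabelling and the scaling (7.2))
  have hcutj : ∀ j : Fin k, HasSmallCut (univ.erase j)
      (fun x : Fin k → ZMod N => f (psi j x) - g (psi j x)) δ₁ := fun j =>
    (hasSmallCut_psi_iff hNk j (fun z => f z - g z) δ₁).mpr
      (hasSmallCut_sum_erase_of_sum_erase j₀ j (fun z => f z - g z) (hcut.mono (min_le_left _ _)))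
  -- Step 5: the counting lemma for the hypergraph system `ν ∘ ψ_j, f ∘ ψ_j, g ∘ ψ_j`
  have hdep : ∀ (F : ZMod N → ℝ) (j : Fin k),
      DependsOn (fun x : Fin k → ZMod N => F (psi j x)) ({j}ᶜ : Set (Fin k)) :=
    fun F j x y hxy => congrArg F (dependsOn_psi j hxy)
  have hcount := hCL' (ZMod N) (fun j x => ν N (psi j x)) (fun j x => f (psi j x))
    (fun j x => g (psi j x)) (hdep (ν N)) (hdep f) (hdep g) (fun j x => hf0 _) (fun j x => hfν _)
    (fun j x => hg0 _) (fun j x => hg1 _) (hL'.mono (min_le_left _ _)) hcutj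
  -- Step 6: reparametrise both simplex counts as AP counts and conclude
  rw [Finset.expect_sub_distrib, expect_prod_psi_eq (by omega) f,
    expect_prod_psi_eq (by omega) g] at hcount
  have h3 := (abs_le.mp hcount).1
  linarith

end Literature.Combinatorics.Additive.CFZ
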